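import Summits.CriticalPhenomena.PercolationContinuityZ3.Theorems.PercAnnulusCrossingIICLevelDecomposition
import HarnessLib

/-!
# Kesten–Basu–Sapozhnikov IIC scheme in boxes, VIII: the inward exploration of a shell and the kernel identity (lane RSW3, p1 gen 3)

builds on p205010 (kernel theorem, internal audit signed; external expert review pending)

Seat `prim-rsw3-p1` (gen 3); LANE-4 blueprint, memo `run/shared/lean/prim/rsw3/P1-QM.md` §13.4 step (3).  Helper file; no definitions, no
sorries; every `d`.  Basu–Sapozhnikov (ECP 22 (2017) §2, the random sets `𝒳_j, 𝒴_j` before (2.8)) explore a shell `Λ(s−1) ∖ Λ(c)` INWARD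
from the sphere `∂ⁱⁿΛ(s)`: here `explSet In' Blk'` of `L/BlockExploration.lean` with `In' = Λ(s−1)ᶜ`, `Blk' = Λ(s−1) ∖ Λ(c)`, read on the
configuration truncated to the pairs of `Λ(s)`.  Data: `Xs ⊆ Λ(s−1) ∖ Λ(c)` (explored shell sites), `Ys ⊆ ∂ⁱⁿΛ(c)` (inner rim); write
`XS = Xs ∪ ∂ⁱⁿΛ(s)`.  Events (written out): `IDAT(Xs,Ys)`; `ILINK(Xs,Ys)` (all attachment points of the inner rim are joined inside `XS`);
for a hole `H ⊆ Λ(c−1)` and a source `X ⊆ Λ(c−1)`: `FIRST(H,X;Xs,Ys) = {X ↔ Ys in Λ(s) ∖ (XS ∪ H)}`; for an outer datum `(U,R)` with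
`Λ(s) ⊆ U`: `SECOND(U,R;Xs,Ys)` (an inner-rim vertex is attached to a site of `XS` joined inside `XS ∪ (U ∖ Λ(s))` to a site of `U` carrying an
open edge to `R`).
* `inner_rim_facts` — on `IDAT` (lattice): inner-rim vertices lie on `∂ⁱⁿΛ(c)`, outside `XS`, are attached to `XS`, and every open edge from
  `XS` to an unexplored site of `Λ(s)` ends in `Ys`;
* **`left_iff_first_and_second`** — on `IDAT ∩ ILINK` (lattice): `LEFT(H,X;U,R) ⟺ FIRST(H,X;Xs,Ys) ∧ SECOND(U,R;Xs,Ys)` (first exit from /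
  last visit to the unexplored part of `Λ(s)`; gluing through `ILINK`) — the event algebra behind Basu–Sapozhnikov's factorisation of the kernel
  `M(U,R;U',R')` (display before (2.8)); the `(H,X)`-dependence sits in `FIRST`, the `(U,R)`-dependence in `SECOND`.
References: D. Basu, A. Sapozhnikov, ECP 22 (2017) no. 26, §2 (before (2.8)); H. Kesten, PTRF 73 (1986) §2.
-/

noncomputable section

namespace Summit.CriticalPhenomena.PercolationContinuityZ3.Theorems.Crossing

open MeasureTheory Literature.Probability.Percolation Literature.Probability.LatticeModels
open Literature.Probability.Percolation.DCT16
open Summit.CriticalPhenomena.PercolationContinuityZ3.Theorems.SurfaceTension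

variable {d : ℕ}

/-! ## The inward datum on lattice configurations -/

/-- For `c + 2 ≤ s`: `Λ(s−1)ᶜ ∪ (Λ(s−1) ∖ Λ(c)) = Λ(c)ᶜ`. [folklore] -/
theorem compl_union_shell {c s : ℕ} (hcs : c + 2 ≤ s) :
    (↑(box d (s - 1)) : Set (Site d))ᶜ ∪ ((↑(box d (s - 1)) : Set (Site d)) \ ↑(box d c)) = (↑(box d c) : Set (Site d))ᶜ := by
  ext x
  simp only [Set.mem_union, Set.mem_compl_iff, Set.mem_sdiff, Finset.mem_coe]
  constructor
  · rintro (h | ⟨-, h⟩)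
    · exact fun hx => h (box_mono d (by omega) hx)
    · exact h
  · intro h
    by_cases hx : x ∈ box d (s - 1)
    · exact Or.inr ⟨hx, h⟩
    · exact Or.inl hx

/-- **Inner rim facts.**  On `IDAT(Xs,Ys)` (lattice configuration, `1 ≤ c`, `c + 2 ≤ s`, `Xs ⊆ Λ(s−1) ∖ Λ(c)`): every `y ∈ Ys` lies on `∂ⁱⁿΛ(c)`,
outside `XS = Xs ∪ ∂ⁱⁿΛ(s)`, and carries an open edge to a site of `XS`; and every open edge from `XS` to a site of `Λ(s) ∖ XS` ends in `Ys`.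
[cite: BasuSapozhnikov2017ECP, §2 (the sets 𝒳_j, 𝒴_j)] -/
theorem inner_rim_facts {c s : ℕ} (hcs : c + 2 ≤ s) {Xs Ys : Finset (Site d)} (hXs : Xs ⊆ box d (s - 1) \ box d c)
    {ω : BondConfig (Site d)} (hω : ω ⊆ (zdGraph d).edgeSet)
    (hI : ω ∩ (↑((box d s).sym2) : Set (Sym2 (Site d))) ∈
      explEvent ((↑(box d (s - 1)) : Set (Site d))ᶜ) ((↑(box d (s - 1)) : Set (Site d)) \ ↑(box d c))
        ((↑(box d (s - 1)) : Set (Site d))ᶜ ∪ ↑Xs) ↑Ys) :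
    (∀ y ∈ Ys, y ∈ innerBoundary (zdGraph d) (box d c) ∧ y ∉ Xs ∪ innerBoundary (zdGraph d) (box d s) ∧
        ∃ z ∈ Xs ∪ innerBoundary (zdGraph d) (box d s), s(z, y) ∈ ω) ∧
      ∀ z ∈ Xs ∪ innerBoundary (zdGraph d) (box d s), ∀ w ∈ box d s, s(z, w) ∈ ω →
        w ∉ Xs ∪ innerBoundary (zdGraph d) (box d s) → w ∈ Ys := by
  obtain ⟨hSet, hRim⟩ := mem_explEvent_iff.1 hI
  have hIB := compl_union_shell (d := d) hcs
  -- the explored sites inside `Λ(s)` are exactly `XS`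
  have hXS : ∀ z : Site d, z ∈ box d s → (z ∈ ((↑(box d (s - 1)) : Set (Site d))ᶜ ∪ ↑Xs) ↔
      z ∈ Xs ∪ innerBoundary (zdGraph d) (box d s)) := by
    intro z hz
    rw [Finset.mem_union, Set.mem_union, Set.mem_compl_iff, Finset.mem_coe, Finset.mem_coe]
    constructor
    · rintro (h | h)
      · exact Or.inr (mem_innerBoundary_box_of_notMem_pred (by omega) hz h)
      · exact Or.inl h
    · rintro (h | h)
      · exact Or.inr h
      · exact Or.inl (notMem_box_of_mem_innerBoundary_box (by omega) h)
  refine ⟨fun y hy => ?_, fun z hz w hw hzw hwX => ?_⟩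
  · have hy' : y ∈ explRim ((↑(box d (s - 1)) : Set (Site d))ᶜ) ((↑(box d (s - 1)) : Set (Site d)) \ ↑(box d c))
        (ω ∩ (↑((box d s).sym2) : Set (Sym2 (Site d)))) := by rw [hRim]; exact Finset.mem_coe.2 hy
    obtain ⟨hyU, z, hz, hzy⟩ := mem_explRim_iff.1 hy'
    have hyc : y ∈ box d c := by
      by_contra h
      exact explRim_disjoint hy' (by rw [hIB]; exact h)
    rw [hSet] at hyU hz
    have hzy' : s(z, y) ∈ ω := hzy.1
    have hzs : z ∈ box d s := by
      have := hzy.2; rw [Finset.coe_sym2, Set.mk_mem_sym2_iff] at this; exact Finset.mem_coe.1 this.1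
    have hzXS : z ∈ Xs ∪ innerBoundary (zdGraph d) (box d s) := (hXS z hzs).1 hz
    have hzc : z ∉ box d c := by
      rcases Finset.mem_union.1 hzXS with h | h
      · exact (Finset.mem_sdiff.1 (hXs h)).2
      · exact fun h' => notMem_box_of_mem_innerBoundary_box (by omega : c < s) h h'
    have hadj : (zdGraph d).Adj z y := by have := hω hzy'; rwa [SimpleGraph.mem_edgeSet] at this
    refine ⟨mem_innerBoundary_iff.2 ⟨hyc, z, hzc, hadj.symm⟩, fun h => hyU ((hXS y (box_mono d (by omega) hyc)).2 h), z, hzXS, hzy'⟩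
  · have hzU : z ∈ ((↑(box d (s - 1)) : Set (Site d))ᶜ ∪ ↑Xs) := by
      have hzs : z ∈ box d s := by
        rcases Finset.mem_union.1 hz with h | h
        · exact box_mono d (by omega) (Finset.mem_sdiff.1 (hXs h)).1
        · exact (Finset.mem_filter.1 h).1
      exact (hXS z hzs).2 hz
    have hzs : z ∈ box d s := by
      rcases Finset.mem_union.1 hz with h | h
      · exact box_mono d (by omega) (Finset.mem_sdiff.1 (hXs h)).1
      · exact (Finset.mem_filter.1 h).1
    have he : s(z, w) ∈ ω ∩ (↑((box d s).sym2) : Set (Sym2 (Site d))) := by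
      refine ⟨hzw, ?_⟩
      rw [Finset.coe_sym2, Set.mk_mem_sym2_iff]
      exact ⟨Finset.mem_coe.2 hzs, Finset.mem_coe.2 hw⟩
    exact Finset.mem_coe.1 (mem_of_mem_explEvent_of_open_edge hI hzU he (fun h => hwX ((hXS w hw).1 h)))

/-! ## The kernel identity `LEFT(H,X;U,R) = FIRST ∧ SECOND` on `IDAT ∩ ILINK` -/

/-- **Decomposition of the kernel event at the inward datum.**  `1 ≤ c`, `c + 2 ≤ s ≤ a ≤ b`, `H, X ⊆ Λ(c−1)`, `Λ(a) ⊆ U`,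
`R ∩ Λ(b) = ∅`, `Xs ⊆ Λ(s−1) ∖ Λ(c)`; lattice `ω ∈ IDAT(Xs,Ys) ∩ ILINK(Xs,Ys)`.  Then
`LEFT(H,X;U,R) ⟺ FIRST(H,X;Xs,Ys) ∧ SECOND(U,R;Xs,Ys)`: the path from `X` to the `R`-attached vertex `v ∉ Λ(s−1)` first leaves the
unexplored part of `Λ(s)` through an inner-rim vertex (prefix = `FIRST`), and after its last visit to that part it runs from an attachment
point inside `XS ∪ (U ∖ Λ(s))` (suffix = `SECOND`); conversely the pieces are glued through `ILINK`.
[cite: BasuSapozhnikov2017ECP, §2 (display before (2.8))] -/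
theorem left_iff_first_and_second {c s a b : ℕ} (hc : 1 ≤ c) (hcs : c + 2 ≤ s) (hsa : s ≤ a) (hab : a ≤ b)
    {H X U R Xs Ys : Finset (Site d)} (hH : H ⊆ box d (c - 1)) (hX : X ⊆ box d (c - 1))
    (hUa : box d a ⊆ U) (hRb : ∀ r ∈ R, r ∉ box d b) (hXs : Xs ⊆ box d (s - 1) \ box d c)
    {ω : BondConfig (Site d)} (hω : ω ⊆ (zdGraph d).edgeSet)
    (hI : ω ∩ (↑((box d s).sym2) : Set (Sym2 (Site d))) ∈
      explEvent ((↑(box d (s - 1)) : Set (Site d))ᶜ) ((↑(box d (s - 1)) : Set (Site d)) \ ↑(box d c))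
        ((↑(box d (s - 1)) : Set (Site d))ᶜ ∪ ↑Xs) ↑Ys)
    (hIL : ω ∈ {ω : BondConfig (Site d) | ∀ y ∈ Ys, ∀ y' ∈ Ys, ∀ z ∈ Xs ∪ innerBoundary (zdGraph d) (box d s),
      ∀ z' ∈ Xs ∪ innerBoundary (zdGraph d) (box d s), s(z, y) ∈ ω → s(z', y') ∈ ω →
      ω ∈ openConnIn (↑(Xs ∪ innerBoundary (zdGraph d) (box d s)) : Set (Site d)) z z'}) :
    ω ∈ {ω : BondConfig (Site d) | ∃ x ∈ X, ∃ r ∈ R, ∃ v ∈ U, ω ∈ openConnIn ((↑U : Set (Site d)) \ ↑H) x v ∧ s(v, r) ∈ ω} ↔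
      ω ∈ {ω : BondConfig (Site d) | ∃ x ∈ X, ∃ y ∈ Ys,
          ω ∈ openConnIn ((↑(box d s) : Set (Site d)) \ (↑(Xs ∪ innerBoundary (zdGraph d) (box d s)) ∪ ↑H)) x y} ∧
        ω ∈ {ω : BondConfig (Site d) | ∃ y ∈ Ys, ∃ z ∈ Xs ∪ innerBoundary (zdGraph d) (box d s), s(z, y) ∈ ω ∧
          ∃ r ∈ R, ∃ v ∈ U, ω ∈ openConnIn ((↑(Xs ∪ innerBoundary (zdGraph d) (box d s)) : Set (Site d)) ∪ (↑U \ ↑(box d s))) z v ∧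
            s(v, r) ∈ ω} := by
  obtain ⟨hrim, hedge⟩ := inner_rim_facts hcs hXs hω hI
  set XS : Finset (Site d) := Xs ∪ innerBoundary (zdGraph d) (box d s) with hXSdef
  -- geometry
  have hXSs : ∀ z ∈ XS, z ∈ box d s := fun z hz => by
    rcases Finset.mem_union.1 hz with h | h
    · exact box_mono d (by omega) (Finset.mem_sdiff.1 (hXs h)).1
    · exact (Finset.mem_filter.1 h).1
  have hXSc : ∀ z ∈ XS, z ∉ box d c := fun z hz h' => by
    rcases Finset.mem_union.1 hz with h | h
    · exact (Finset.mem_sdiff.1 (hXs h)).2 h'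
    · exact notMem_box_of_mem_innerBoundary_box (by omega : c < s) h h'
  have hHc : H ⊆ box d c := hH.trans (box_mono d (Nat.sub_le c 1))
  have hcU : box d s ⊆ U := (box_mono d hsa).trans hUa
  have hXSUH : (↑XS : Set (Site d)) ⊆ (↑U : Set (Site d)) \ ↑H := fun z hz =>
    ⟨Finset.mem_coe.2 (hcU (hXSs z (Finset.mem_coe.1 hz))), fun h => hXSc z (Finset.mem_coe.1 hz) (hHc (Finset.mem_coe.1 h))⟩
  have hYUH : ∀ y ∈ Ys, y ∈ (↑U : Set (Site d)) \ ↑H := fun y hy =>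
    ⟨Finset.mem_coe.2 (hcU (box_mono d (by omega) (Finset.mem_filter.1 (hrim y hy).1).1)),
      fun h => notMem_box_of_mem_innerBoundary_box (by omega : c - 1 < c) (hrim y hy).1 (hH (Finset.mem_coe.1 h))⟩
  have ne_of_mem : ∀ {x y : Site d}, s(x, y) ∈ ω → x ≠ y := fun he =>
    (show (zdGraph d).Adj _ _ by have := hω he; rwa [SimpleGraph.mem_edgeSet] at this).ne
  set C₀ : Set (Site d) := (↑(box d s) : Set (Site d)) \ ↑XS with hC₀
  constructor
  · rintro ⟨x, hx, r, hr, v, hv, hxv, hvr⟩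
    have hvs1 : v ∉ box d (s - 1) := by
      intro h
      have hadj : (zdGraph d).Adj v r := by have := hω hvr; rwa [SimpleGraph.mem_edgeSet] at this
      exact hRb r hr (by
        have := mem_box_succ_of_adj_box hadj (box_mono d (by omega : s - 1 ≤ b - 1) h)
        rwa [Nat.sub_add_cancel (by omega : 1 ≤ b)] at this)
    have hP := pathIn_of_mem_openConnIn hxv
    have hxC : x ∈ C₀ := by
      refine ⟨Finset.mem_coe.2 (box_mono d (by omega) (hX hx)), fun h => hXSc x (Finset.mem_coe.1 h) ?_⟩
      exact box_mono d (Nat.sub_le c 1) (hX hx)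
    have hvC : v ∉ C₀ := by
      rintro ⟨hvs, hvXS⟩
      exact hvXS (Finset.mem_coe.2 (Finset.mem_union_right _
        (mem_innerBoundary_box_of_notMem_pred (by omega) (Finset.mem_coe.1 hvs) hvs1)))
    -- on leaving `C₀` from `u ∈ Λ(s−1)` one lands in `XS`
    have hland : ∀ u w : Site d, u ∈ C₀ → w ∉ C₀ → (openGraph ω).Adj u w → w ∈ XS ∧ u ∈ Ys := by
      intro u w huC hwC hadj
      rw [openGraph_adj] at hadj
      have hus : u ∈ box d s := Finset.mem_coe.1 huC.1
      have hus1 : u ∈ box d (s - 1) := by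
        by_contra h
        exact huC.2 (Finset.mem_coe.2 (Finset.mem_union_right _ (mem_innerBoundary_box_of_notMem_pred (by omega) hus h)))
      have hws : w ∈ box d s := by
        have := mem_box_succ_of_adj_box (adj_of_openGraph_adj hω ((openGraph_adj ω u w).2 hadj)) hus1
        rwa [Nat.sub_add_cancel (by omega : 1 ≤ s)] at this
      have hwXS : w ∈ XS := by
        by_contra h
        exact hwC ⟨Finset.mem_coe.2 hws, fun h' => h (Finset.mem_coe.1 h')⟩
      refine ⟨hwXS, hedge w hwXS u hus (by rw [Sym2.eq_swap]; exact hadj.1) (fun h => huC.2 (Finset.mem_coe.2 h))⟩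
    constructor
    · obtain ⟨u, w, huC, hwC, -, hadj, hpre⟩ := hP.exit hxC hvC
      obtain ⟨-, huY⟩ := hland u w huC hwC hadj
      refine ⟨x, hx, u, huY, mem_openConnIn_of_pathIn (hpre.mono ?_)⟩
      rintro z ⟨⟨hzs, hzXS⟩, -, hzH⟩
      exact ⟨hzs, fun h => h.elim (fun h' => hzXS h') (fun h' => hzH h')⟩
    · obtain ⟨y₂, z, hy₂C, -, hzC, hadj, hsuf⟩ := hP.last_exit (C := C₀) hxC hvC
      obtain ⟨hzXS, hy₂Y⟩ := hland y₂ z hy₂C hzC hadj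
      have hzy₂ : s(z, y₂) ∈ ω := by rw [Sym2.eq_swap]; exact ((openGraph_adj ω y₂ z).1 hadj).1
      refine ⟨y₂, hy₂Y, z, hzXS, hzy₂, r, hr, v, hv, mem_openConnIn_of_pathIn (hsuf.mono ?_), hvr⟩
      rintro w' ⟨⟨hw'U, -⟩, hw'C⟩
      by_cases hw's : w' ∈ (↑(box d s) : Set (Site d))
      · left
        by_contra h
        exact hw'C ⟨hw's, h⟩
      · exact Or.inr ⟨hw'U, hw's⟩
  · rintro ⟨⟨x, hx, y₀, hy₀, hxy₀⟩, y₂, hy₂, z, hz, hzy₂, r, hr, v, hv, hzv, hvr⟩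
    obtain ⟨-, -, w₀, hw₀, hw₀y₀⟩ := hrim y₀ hy₀
    have hlink := hIL y₀ hy₀ y₂ hy₂ w₀ hw₀ z hz hw₀y₀ hzy₂
    refine ⟨x, hx, r, hr, v, hv, ?_, hvr⟩
    have h1 : ω ∈ openConnIn ((↑U : Set (Site d)) \ ↑H) x y₀ := by
      refine openConnIn_mono ?_ _ _ hxy₀
      rintro w ⟨hws, hw⟩
      exact ⟨Finset.mem_coe.2 (hcU (Finset.mem_coe.1 hws)), fun h => hw (Or.inr h)⟩
    have h2 : ω ∈ openConnIn ((↑U : Set (Site d)) \ ↑H) y₀ w₀ := by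
      rw [openConnIn_comm]
      exact openConnIn_of_adj (hXSUH (Finset.mem_coe.2 hw₀)) (hYUH y₀ hy₀) hw₀y₀ (ne_of_mem hw₀y₀)
    have h3 : ω ∈ openConnIn ((↑U : Set (Site d)) \ ↑H) w₀ z := openConnIn_mono hXSUH _ _ hlink
    have h4 : ω ∈ openConnIn ((↑U : Set (Site d)) \ ↑H) z v := by
      refine openConnIn_mono ?_ _ _ hzv
      rintro w (hw | ⟨hwU, hws⟩)
      · exact hXSUH hw
      · exact ⟨hwU, fun h => hws (Finset.mem_coe.2 (box_mono d (by omega) (hHc (Finset.mem_coe.1 h))))⟩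
    exact PlanarDuality.openConnIn_trans (PlanarDuality.openConnIn_trans (PlanarDuality.openConnIn_trans h1 h2) h3) h4

end Summit.CriticalPhenomena.PercolationContinuityZ3.Theorems.Crossing

end
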